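import Mathlib
import Summits.NavierStokesRegularity.FluidComputer.TransportGalerkinLipschitz
import Summits.NavierStokesRegularity.FluidComputer.GalerkinLatticeContinuity
import HarnessLib

/-!
# The transport Galerkin model: condition (C1) and the Galerkin convergence setting from primitive data (instab g17, cell `ns-blowup`, 2026-08-27)

HONEST FRAMING (human ruling D-0035): nothing here is a claim about Navier–Stokes blow-up.
WHAT THIS IS NOT: not NS evidence — the last typing step of the model instance «(β2)» of the R-β
emergence chain (`HOME/instab/BETA2-SPEC.md` §4 and §1–§5 assembled): for `F = nsField ν Uv π P` on
the `H²`-scaled lattice phase space and `W = box ρ π P`,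

* §1 `H²`-level bounds of the coefficient fields: `‖lin w‖₂ ≤ K_lin ‖w‖₄`, `‖bil(w, u)‖₂ ≤ 2C·A₃(u)·‖w‖₄`,
  `‖bil(v, w)‖₂ ≤ S(v)·2π·‖w‖₄` (from `TransportGalerkinLipschitz` §2);
* §2 on the box: the fields take their defining values (`coe_nsField_sub_of_mem_box`) and
  `‖F x − F y‖² ≤ L² ‖⇑x − ⇑y‖₂²` (`norm_nsField_sub_sq_le`, hypothesis `hLip` of
  `GalerkinLatticeContinuity.continuousOn_of_lipschitz_level`, `t = 2`);
* §3 uniform `H²`-tails of `W` from `∑_k ⟨k⟩⁴ρ_k² < ∞` (`box_uniform_tail`) and **`continuousOn_nsField`**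
  = condition (C1) of `Literature.Analysis.ODE.GalerkinConvergenceSetting`;
* §4 **`galerkinSetting_nsField`** — the setting for `(cubeProj, nsField ν Uv π P, box ρ π P)` from
  PRIMITIVE data only: the host (`ν ≥ 0`, `Uv` rapidly decreasing, real and divergence-free through
  `π`, `‖π_j‖ ≤ 1`, `P` self-adjoint contractions), the radii (`ρ ≥ 0`, `∑⟨l⟩ρ_l < ∞`,
  `∑⟨k⟩⁴ρ_k² < ∞`), a proper fibre `V`, and the RESIDENCE data (β3). With it the (β2) residue of
  BETA2-SPEC is nil: `GalerkinEmergenceCertificate.half_prediction_of_head_tail_certificate` /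
  `decay_two_of_head_tail_certificate` apply to the model with the split `nsField_eq`.

Mathlib + the tree files cited; no new definitions.
-/

noncomputable section

namespace Summit.NavierStokesRegularity.FluidComputer.TransportGalerkinContinuity

open Set Filter Topology Finset
open Literature.Analysis.FunctionSpaces Literature.Analysis.FunctionSpaces.Lattice
open Literature.Analysis.FunctionSpaces.Torus Literature.Analysis.ODE
open Summit.NavierStokesRegularity.FluidComputer.GalerkinLatticePhaseSpace
open Summit.NavierStokesRegularity.FluidComputer.GalerkinLatticeContinuity
open Summit.NavierStokesRegularity.FluidComputer.TransportGalerkin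
open Summit.NavierStokesRegularity.FluidComputer.TransportGalerkinBox
open Summit.NavierStokesRegularity.FluidComputer.TransportCommutatorLattice
open Summit.NavierStokesRegularity.FluidComputer.TransportSkewLattice
open Summit.NavierStokesRegularity.FluidComputer.TransportGalerkinRapid
open Summit.NavierStokesRegularity.FluidComputer.TransportGalerkinOneSided
open Summit.NavierStokesRegularity.FluidComputer.TransportGalerkinLipschitz
open scoped ENNReal NNReal ComplexConjugate InnerProductSpace

variable {d : Type*} [Fintype d] [DecidableEq d]
variable {V : Type*} [NormedAddCommGroup V] [InnerProductSpace ℂ V] [CompleteSpace V]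
variable {ρ : (d → ℤ) → ℝ} {ν : ℝ} {Uv : (d → ℤ) → V} {π : d → (V →L[ℂ] ℂ)} {P : (d → ℤ) → (V →L[ℂ] V)}

/-! ## §1 `H²`-level bounds of the coefficient fields -/

omit [DecidableEq d] [CompleteSpace V] in
/-- **The linearised field costs two levels**: for every family `w`,
`‖linCoeff ν Uv π w‖₂ ≤ (|ν|·card d·(2π)² + S_U·2π + 2C·A₃(Uv)) ‖w‖₄`, `S_U = ∑_j 2^{|2|/2}A_{|2|}(scal (π_j∘Uv))`,
`C = card d·2π` (components `π_j` of norm `≤ 1`). -/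
theorem eNorm_two_linCoeff_le (hπ : ∀ j, ‖π j‖ ≤ 1) (w : (d → ℤ) → V) :
    eNorm 2 (linCoeff ν Uv π w) ≤
      (‖(ν : ℂ)‖ₑ * ((Fintype.card d : ℝ≥0∞) * (ENNReal.ofReal (2 * Real.pi) * ENNReal.ofReal (2 * Real.pi)))
        + (∑ j, ENNReal.ofReal ((2 : ℝ) ^ (|(2 : ℝ)| / 2)) *
            symbNorm |(2 : ℝ)| (scal (fun p => π j (Uv p)) : (d → ℤ) → (V →L[ℂ] V))) * ENNReal.ofReal (2 * Real.pi)
        + 2 * ((Fintype.card d : ℝ≥0∞) * ENNReal.ofReal (2 * Real.pi)) *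
            (∑' l, ENNReal.ofReal (sobolevWeight 3 l) * ‖Uv l‖ₑ)) * eNorm 4 w := by
  have h34 : eNorm 3 w ≤ eNorm 4 w := eNorm_mono (by norm_num) w
  have h24 : eNorm 2 w ≤ eNorm 4 w := eNorm_mono (by norm_num) w
  -- name the three constants
  obtain ⟨K₁, hK₁⟩ : ∃ K : ℝ≥0∞, K = ‖(ν : ℂ)‖ₑ *
      ((Fintype.card d : ℝ≥0∞) * (ENNReal.ofReal (2 * Real.pi) * ENNReal.ofReal (2 * Real.pi))) := ⟨_, rfl⟩
  obtain ⟨K₂, hK₂⟩ : ∃ K : ℝ≥0∞, K = (∑ j, ENNReal.ofReal ((2 : ℝ) ^ (|(2 : ℝ)| / 2)) *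
      symbNorm |(2 : ℝ)| (scal (fun p => π j (Uv p)) : (d → ℤ) → (V →L[ℂ] V))) *
        ENNReal.ofReal (2 * Real.pi) := ⟨_, rfl⟩
  obtain ⟨K₃, hK₃⟩ : ∃ K : ℝ≥0∞, K = 2 * ((Fintype.card d : ℝ≥0∞) * ENNReal.ofReal (2 * Real.pi)) *
      (∑' l, ENNReal.ofReal (sobolevWeight 3 l) * ‖Uv l‖ₑ) := ⟨_, rfl⟩
  rw [← hK₁, ← hK₂, ← hK₃]
  -- the three pieces
  have hLb : eNorm 2 ((ν : ℂ) • ∑ j, freqDeriv j (freqDeriv j w)) ≤ K₁ * eNorm 4 w := by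
    rw [eNorm_const_smul, hK₁, mul_assoc]
    exact mul_le_mul_right (eNorm_two_laplacian_le w) _
  have hT₁b : eNorm 2 (∑ j, conv (scal (fun p => π j (Uv p)) : (d → ℤ) → (V →L[ℂ] V)) (freqDeriv j w)) ≤
      K₂ * eNorm 4 w := by
    refine (eNorm_two_transport_symb_le (fun j p => π j (Uv p)) w).trans ?_
    rw [hK₂, mul_assoc]
    exact mul_le_mul_right (mul_le_mul_right h34 _) _
  have hT₂b : eNorm 2 (∑ j, conv (scal (fun p => π j (w p)) : (d → ℤ) → (V →L[ℂ] V)) (freqDeriv j Uv)) ≤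
      K₃ * eNorm 4 w := by
    rw [hK₃]
    exact (eNorm_two_transport_first_le (fun j p => π j (w p)) w (norm_comp_le π hπ w) Uv).trans
      (mul_le_mul_right h24 _)
  rw [linCoeff_eq, add_mul, add_mul]
  exact ((eNorm_sub_le 2 _ _).trans (add_le_add_left (eNorm_sub_le 2 _ _) _)).trans
    (add_le_add (add_le_add hLb hT₁b) hT₂b)

omit [DecidableEq d] [CompleteSpace V] in
/-- **The bilinearity in the first slot**: `‖bilCoeff π w u‖₂ ≤ 2C·A₃(u)·‖w‖₄`. -/
theorem eNorm_two_bilCoeff_first_le (hπ : ∀ j, ‖π j‖ ≤ 1) (w u : (d → ℤ) → V) :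
    eNorm 2 (bilCoeff π w u) ≤ 2 * ((Fintype.card d : ℝ≥0∞) * ENNReal.ofReal (2 * Real.pi)) *
      (∑' l, ENNReal.ofReal (sobolevWeight 3 l) * ‖u l‖ₑ) * eNorm 4 w := by
  rw [bilCoeff_eq, eNorm_neg']
  exact (eNorm_two_transport_first_le (fun j p => π j (w p)) w (norm_comp_le π hπ w) u).trans
    (mul_le_mul_right (eNorm_mono (by norm_num) w) _)

omit [DecidableEq d] [CompleteSpace V] in
/-- **The bilinearity in the second slot**: `‖bilCoeff π v w‖₂ ≤ S(v)·2π·‖w‖₄`,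
`S(v) = ∑_j 2^{|2|/2} A_{|2|}(scal (π_j∘v))`. -/
theorem eNorm_two_bilCoeff_second_le (v w : (d → ℤ) → V) :
    eNorm 2 (bilCoeff π v w) ≤ (∑ j, ENNReal.ofReal ((2 : ℝ) ^ (|(2 : ℝ)| / 2)) *
        symbNorm |(2 : ℝ)| (scal (fun p => π j (v p)) : (d → ℤ) → (V →L[ℂ] V))) *
      ENNReal.ofReal (2 * Real.pi) * eNorm 4 w := by
  rw [bilCoeff_eq, eNorm_neg']
  refine (eNorm_two_transport_symb_le (fun j p => π j (v p)) w).trans ?_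
  rw [mul_assoc]
  exact mul_le_mul_right (mul_le_mul_right (eNorm_mono (by norm_num) w) _) _

/-! ## §2 On the box: defining values and the Lipschitz bound -/

omit [DecidableEq d] [CompleteSpace V] in
/-- The constant of `eNorm_two_linCoeff_le` is finite for a rapidly decreasing host. -/
theorem linConst_lt_top (hUv : RapidDecay Uv) :
    ‖(ν : ℂ)‖ₑ * ((Fintype.card d : ℝ≥0∞) * (ENNReal.ofReal (2 * Real.pi) * ENNReal.ofReal (2 * Real.pi)))
        + (∑ j, ENNReal.ofReal ((2 : ℝ) ^ (|(2 : ℝ)| / 2)) *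
            symbNorm |(2 : ℝ)| (scal (fun p => π j (Uv p)) : (d → ℤ) → (V →L[ℂ] V))) * ENNReal.ofReal (2 * Real.pi)
        + 2 * ((Fintype.card d : ℝ≥0∞) * ENNReal.ofReal (2 * Real.pi)) *
            (∑' l, ENNReal.ofReal (sobolevWeight 3 l) * ‖Uv l‖ₑ) < ∞ := by
  refine ENNReal.add_lt_top.2 ⟨ENNReal.add_lt_top.2 ⟨?_, ?_⟩, ?_⟩
  · exact ENNReal.mul_lt_top enorm_lt_top (ENNReal.mul_lt_top (by simp)
      (ENNReal.mul_lt_top ENNReal.ofReal_lt_top ENNReal.ofReal_lt_top))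
  · exact ENNReal.mul_lt_top (ENNReal.sum_lt_top.2 fun j _ => ENNReal.mul_lt_top ENNReal.ofReal_lt_top
      (symbNorm_lt_top_of_rapidDecay (hUv.comp_apply (π j)).scal _)) ENNReal.ofReal_lt_top
  · exact ENNReal.mul_lt_top (ENNReal.mul_lt_top (by norm_num) (ENNReal.mul_lt_top (by simp)
      ENNReal.ofReal_lt_top)) (tsum_weight_mul_enorm_lt_top hUv 3)

omit [DecidableEq d] [CompleteSpace V] in
/-- **On the box `linOp` takes its defining value** (the linearised field of an `H⁴` family lies in `H²`). -/
theorem coe_linOp_of_mem_box (hUv : RapidDecay Uv) (hπ : ∀ j, ‖π j‖ ≤ 1) (hPn : ∀ k, ‖P k‖ ≤ 1)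
    (hρ2 : Summable fun k => (sobolevWeight 2 k * ρ k) ^ 2) {x : lp (fun _ : (d → ℤ) => V) 2}
    (hx : x ∈ box ρ π P) :
    ⇑(linOp ν Uv π P x) = wmul 2 fun k => P k (linCoeff ν Uv π (wmul (-2) ⇑x) k) := by
  refine coe_linOp ?_
  rw [eNormSq_wmul, zero_add]
  refine (eNormSq_apply_le_of_opNorm_le_one P hPn 2 _).trans_lt ?_
  rw [← eNorm_lt_top_iff]
  exact (eNorm_two_linCoeff_le hπ _).trans_lt (ENNReal.mul_lt_top (linConst_lt_top hUv)
    (eNorm_lt_top_iff.2 (eNormSq_four_unscale_lt_top hρ2 hx)))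

omit [DecidableEq d] [CompleteSpace V] in
/-- **On the box `bilOp x x` takes its defining value** (first-slot bound with `A₃ ≤ R₁`). -/
theorem coe_bilOp_of_mem_box (hπ : ∀ j, ‖π j‖ ≤ 1) (hPn : ∀ k, ‖P k‖ ≤ 1) (hρ0 : ∀ k, 0 ≤ ρ k)
    (hρ1 : Summable fun k => sobolevWeight 1 k * ρ k) (hρ2 : Summable fun k => (sobolevWeight 2 k * ρ k) ^ 2)
    {x : lp (fun _ : (d → ℤ) => V) 2} (hx : x ∈ box ρ π P) :
    ⇑(bilOp π P x x) = wmul 2 fun k => P k (bilCoeff π (wmul (-2) ⇑x) (wmul (-2) ⇑x) k) := by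
  refine coe_bilOp ?_
  rw [eNormSq_wmul, zero_add]
  refine (eNormSq_apply_le_of_opNorm_le_one P hPn 2 _).trans_lt ?_
  rw [← eNorm_lt_top_iff]
  refine (eNorm_two_bilCoeff_first_le hπ _ _).trans_lt (ENNReal.mul_lt_top ?_
    (eNorm_lt_top_iff.2 (eNormSq_four_unscale_lt_top hρ2 hx)))
  exact ENNReal.mul_lt_top (ENNReal.mul_lt_top (by norm_num) (ENNReal.mul_lt_top (by simp)
    ENNReal.ofReal_lt_top)) ((weightThree_unscale_le hρ0 hρ1 hx).trans_lt ENNReal.ofReal_lt_top)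

omit [DecidableEq d] in
/-- The coefficients of `F x − F y` for two box elements: `P ∘ Λ² (lin (u − v) + (bil(u,u) − bil(v,v)))`. -/
theorem coe_nsField_sub_of_mem_box (hUv : RapidDecay Uv) (hπ : ∀ j, ‖π j‖ ≤ 1) (hPn : ∀ k, ‖P k‖ ≤ 1)
    (hρ0 : ∀ k, 0 ≤ ρ k) (hρ1 : Summable fun k => sobolevWeight 1 k * ρ k)
    (hρ2 : Summable fun k => (sobolevWeight 2 k * ρ k) ^ 2)
    {x y : lp (fun _ : (d → ℤ) => V) 2} (hx : x ∈ box ρ π P) (hy : y ∈ box ρ π P) :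
    ⇑(nsField ν Uv π P x - nsField ν Uv π P y) = fun k => P k (wmul 2
      (linCoeff ν Uv π (wmul (-2) ⇑x - wmul (-2) ⇑y) +
        (bilCoeff π (wmul (-2) ⇑x) (wmul (-2) ⇑x) - bilCoeff π (wmul (-2) ⇑y) (wmul (-2) ⇑y))) k) := by
  rw [lp.coeFn_sub, nsField_eq, nsField_eq, lp.coeFn_add, lp.coeFn_add,
    coe_linOp_of_mem_box hUv hπ hPn hρ2 hx, coe_linOp_of_mem_box hUv hπ hPn hρ2 hy,
    coe_bilOp_of_mem_box hπ hPn hρ0 hρ1 hρ2 hx, coe_bilOp_of_mem_box hπ hPn hρ0 hρ1 hρ2 hy,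
    linCoeff_sub_box (ν := ν) hUv hπ hρ0 hρ1 hρ2 hx hy]
  funext k
  simp only [Pi.sub_apply, Pi.add_apply, wmul_apply, map_smul, map_add, map_sub, smul_add, smul_sub]
  abel

omit [DecidableEq d] in
/-- **THE LIPSCHITZ BOUND ON THE BOX** (hypothesis `hLip` of
`GalerkinLatticeContinuity.continuousOn_of_lipschitz_level` with `t = 2`): there is `L` with
`‖F x − F y‖² ≤ L² · ‖⇑x − ⇑y‖₂²` for all `x, y ∈ W`. -/
theorem norm_nsField_sub_sq_le (hUv : RapidDecay Uv) (hπ : ∀ j, ‖π j‖ ≤ 1) (hPn : ∀ k, ‖P k‖ ≤ 1)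
    (hρ0 : ∀ k, 0 ≤ ρ k) (hρ1 : Summable fun k => sobolevWeight 1 k * ρ k)
    (hρ2 : Summable fun k => (sobolevWeight 2 k * ρ k) ^ 2) :
    ∃ L : ℝ, ∀ x ∈ box ρ π P, ∀ y ∈ box ρ π P,
      ‖nsField ν Uv π P x - nsField ν Uv π P y‖ ^ 2 ≤ L ^ 2 * (eNormSq 2 (⇑x - ⇑y)).toReal := by
  -- the constants
  obtain ⟨Klin, hKlin⟩ : ∃ K : ℝ≥0∞, K =
      ‖(ν : ℂ)‖ₑ * ((Fintype.card d : ℝ≥0∞) * (ENNReal.ofReal (2 * Real.pi) * ENNReal.ofReal (2 * Real.pi)))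
        + (∑ j, ENNReal.ofReal ((2 : ℝ) ^ (|(2 : ℝ)| / 2)) *
            symbNorm |(2 : ℝ)| (scal (fun p => π j (Uv p)) : (d → ℤ) → (V →L[ℂ] V))) * ENNReal.ofReal (2 * Real.pi)
        + 2 * ((Fintype.card d : ℝ≥0∞) * ENNReal.ofReal (2 * Real.pi)) *
            (∑' l, ENNReal.ofReal (sobolevWeight 3 l) * ‖Uv l‖ₑ) := ⟨_, rfl⟩
  obtain ⟨R₁, hR₁⟩ : ∃ R : ℝ, R = ∑' l, sobolevWeight 1 l * ρ l := ⟨_, rfl⟩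
  have hR₁0 : 0 ≤ R₁ := hR₁ ▸ tsum_nonneg fun l => mul_nonneg (sobolevWeight_pos _ _).le (hρ0 l)
  obtain ⟨K, hK⟩ : ∃ K : ℝ≥0∞, K = Klin
      + 2 * ((Fintype.card d : ℝ≥0∞) * ENNReal.ofReal (2 * Real.pi)) * ENNReal.ofReal R₁
      + (Fintype.card d : ℝ≥0∞) * (ENNReal.ofReal ((2 : ℝ) ^ (|(2 : ℝ)| / 2)) * ENNReal.ofReal R₁) *
          ENNReal.ofReal (2 * Real.pi) := ⟨_, rfl⟩
  have hKfin : K < ∞ := by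
    rw [hK]
    refine ENNReal.add_lt_top.2 ⟨ENNReal.add_lt_top.2 ⟨hKlin ▸ linConst_lt_top hUv, ?_⟩, ?_⟩
    · exact ENNReal.mul_lt_top (ENNReal.mul_lt_top (by norm_num) (ENNReal.mul_lt_top (by simp)
        ENNReal.ofReal_lt_top)) ENNReal.ofReal_lt_top
    · exact ENNReal.mul_lt_top (ENNReal.mul_lt_top (by simp) (ENNReal.mul_lt_top ENNReal.ofReal_lt_top
        ENNReal.ofReal_lt_top)) ENNReal.ofReal_lt_top
  refine ⟨K.toReal, fun x hx y hy => ?_⟩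
  set u := wmul (-2) (⇑x) with hu
  set v := wmul (-2) (⇑y) with hv
  set w := u - v with hw
  -- the `H²` bound of the coefficient field of the difference
  have hbil := bilCoeff_sub_split_box hπ hρ0 hρ1 hx hy
  rw [← hu, ← hv, ← hw] at hbil
  have h1 : eNorm 2 (bilCoeff π w u) ≤
      2 * ((Fintype.card d : ℝ≥0∞) * ENNReal.ofReal (2 * Real.pi)) * ENNReal.ofReal R₁ * eNorm 4 w := by
    refine (eNorm_two_bilCoeff_first_le hπ w u).trans ?_
    gcongr
    exact hR₁ ▸ weightThree_unscale_le hρ0 hρ1 hx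
  have h2 : eNorm 2 (bilCoeff π v w) ≤ (Fintype.card d : ℝ≥0∞) *
      (ENNReal.ofReal ((2 : ℝ) ^ (|(2 : ℝ)| / 2)) * ENNReal.ofReal R₁) * ENNReal.ofReal (2 * Real.pi) *
        eNorm 4 w := by
    refine (eNorm_two_bilCoeff_second_le v w).trans ?_
    gcongr
    calc (∑ j, ENNReal.ofReal ((2 : ℝ) ^ (|(2 : ℝ)| / 2)) *
          symbNorm |(2 : ℝ)| (scal (fun p => π j (v p)) : (d → ℤ) → (V →L[ℂ] V)))
        ≤ ∑ _j : d, ENNReal.ofReal ((2 : ℝ) ^ (|(2 : ℝ)| / 2)) * ENNReal.ofReal R₁ :=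
          Finset.sum_le_sum fun j _ => by
            gcongr
            rw [abs_two, hR₁]
            exact symbNorm_two_scal_comp_le hρ0 hρ1 hπ hy j
      _ = _ := by rw [Finset.sum_const, Finset.card_univ, nsmul_eq_mul]
  have hg : eNorm 2 (linCoeff ν Uv π w + (bilCoeff π u u - bilCoeff π v v)) ≤ K * eNorm 4 w := by
    rw [hbil, hK, add_mul, add_mul]
    calc eNorm 2 (linCoeff ν Uv π w + (bilCoeff π w u + bilCoeff π v w))
        ≤ eNorm 2 (linCoeff ν Uv π w) + eNorm 2 (bilCoeff π w u + bilCoeff π v w) := eNorm_add_le 2 _ _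
      _ ≤ eNorm 2 (linCoeff ν Uv π w) + (eNorm 2 (bilCoeff π w u) + eNorm 2 (bilCoeff π v w)) :=
          add_le_add_right (eNorm_add_le 2 _ _) _
      _ ≤ Klin * eNorm 4 w + (2 * ((Fintype.card d : ℝ≥0∞) * ENNReal.ofReal (2 * Real.pi)) *
            ENNReal.ofReal R₁ * eNorm 4 w + (Fintype.card d : ℝ≥0∞) *
            (ENNReal.ofReal ((2 : ℝ) ^ (|(2 : ℝ)| / 2)) * ENNReal.ofReal R₁) * ENNReal.ofReal (2 * Real.pi) *
              eNorm 4 w) := add_le_add (hKlin ▸ eNorm_two_linCoeff_le hπ w) (add_le_add h1 h2)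
      _ = _ := by rw [add_assoc]
  -- the `E`-norm of `F x − F y`
  have h0 : eNormSq 0 (⇑(nsField ν Uv π P x - nsField ν Uv π P y)) ≤ (K * eNorm 4 w) ^ 2 := by
    rw [coe_nsField_sub_of_mem_box hUv hπ hPn hρ0 hρ1 hρ2 hx hy, ← hu, ← hv, ← hw]
    refine (eNormSq_apply_le_of_opNorm_le_one P hPn 0 _).trans ?_
    rw [eNormSq_wmul, zero_add, ← eNorm_pow_two]
    exact pow_le_pow_left' hg 2
  have hw4 : eNorm 4 w = eNorm 2 (⇑x - ⇑y) := by
    rw [hw, hu, hv, ← wmul_sub, eNorm_wmul]; norm_num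
  have hw4' : eNormSq 4 w = eNormSq 2 (⇑x - ⇑y) := by
    rw [hw, hu, hv, ← wmul_sub, eNormSq_wmul]; norm_num
  have hxy : eNormSq 2 (⇑x - ⇑y) < ∞ :=
    (eNormSq_sub_le 2 _ _).trans_lt (ENNReal.add_lt_top.2
      ⟨ENNReal.mul_lt_top (by norm_num) ((eNormSq_two_coe_le hρ2 hx).trans_lt ENNReal.ofReal_lt_top),
       ENNReal.mul_lt_top (by norm_num) ((eNormSq_two_coe_le hρ2 hy).trans_lt ENNReal.ofReal_lt_top)⟩)
  have hfin : (K * eNorm 4 w) ^ 2 ≠ ∞ :=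
    ENNReal.pow_ne_top (ENNReal.mul_ne_top hKfin.ne (by rw [hw4]; exact (eNorm_lt_top_iff.2 hxy).ne))
  have h := ENNReal.toReal_mono hfin h0
  rw [← norm_sq_eq_toReal_eNormSq_zero, mul_pow, ENNReal.toReal_mul, ENNReal.toReal_pow, eNorm_pow_two,
    hw4'] at h
  exact h

/-! ## §3 Uniform tails of the box and condition (C1) -/

omit [DecidableEq d] [CompleteSpace V] in
/-- **`W` has uniform `H²`-tails** (scaled families): for every `τ > 0` one finite set of modes `K`
bounds `‖⇑x − 𝟙_K ⇑x‖₂² ≤ τ` for all `x ∈ W`, since the box terms are dominated by the summable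
`(⟨k⟩²ρ_k)²`. -/
theorem box_uniform_tail (hρ2 : Summable fun k => (sobolevWeight 2 k * ρ k) ^ 2) :
    ∀ τ : ℝ, 0 < τ → ∃ K : Finset (d → ℤ), ∀ x ∈ box ρ π P,
      eNormSq 2 (⇑x - trunc K ⇑x) ≤ ENNReal.ofReal τ := by
  intro τ hτ
  have hg : ∑' k, ENNReal.ofReal ((sobolevWeight 2 k * ρ k) ^ 2) ≠ ∞ := by
    rw [← ENNReal.ofReal_tsum_of_nonneg (fun k => sq_nonneg _) hρ2]; exact ENNReal.ofReal_ne_top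
  have ht := ENNReal.tendsto_tsum_compl_atTop_zero hg
  have ht' : Tendsto (fun K : Finset (d → ℤ) => ∑' k, (↑K : Set (d → ℤ))ᶜ.indicator
      (fun k => ENNReal.ofReal ((sobolevWeight 2 k * ρ k) ^ 2)) k) atTop (𝓝 0) := by
    refine ht.congr fun K => ?_
    rw [← _root_.tsum_subtype]
    rfl
  obtain ⟨K, hK⟩ := ENNReal.tendsto_atTop_zero.1 ht' (ENNReal.ofReal τ) (ENNReal.ofReal_pos.2 hτ)
  refine ⟨K, fun x hx => ?_⟩
  have hterm : ∀ k, ENNReal.ofReal (sobolevWeight 2 k ^ 2) * ‖(⇑x) k‖ₑ ^ 2 ≤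
      ENNReal.ofReal ((sobolevWeight 2 k * ρ k) ^ 2) := fun k => by
    rw [← ofReal_norm, ← ENNReal.ofReal_pow (norm_nonneg _), ← ENNReal.ofReal_mul (sq_nonneg _)]
    refine ENNReal.ofReal_le_ofReal ?_
    rw [mul_pow]
    exact mul_le_mul_of_nonneg_left (pow_le_pow_left₀ (norm_nonneg _) (hx.1 k) 2) (sq_nonneg _)
  rw [eNormSq_sub_trunc]
  exact (ENNReal.tsum_le_tsum fun k => Set.indicator_le_indicator (hterm k)).trans (hK K le_rfl)

omit [DecidableEq d] in
/-- **CONDITION (C1) FOR THE TRANSPORT MODEL**: `F = nsField ν Uv π P` is continuous on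
`W = box ρ π P` (rapidly decreasing host, components of norm `≤ 1`, contraction `P`, radii with
`∑⟨l⟩ρ_l < ∞` and `∑⟨k⟩⁴ρ_k² < ∞`) — the field `continuousOn` of
`Literature.Analysis.ODE.GalerkinConvergenceSetting`. -/
theorem continuousOn_nsField (hUv : RapidDecay Uv) (hπ : ∀ j, ‖π j‖ ≤ 1) (hPn : ∀ k, ‖P k‖ ≤ 1)
    (hρ0 : ∀ k, 0 ≤ ρ k) (hρ1 : Summable fun k => sobolevWeight 1 k * ρ k)
    (hρ2 : Summable fun k => (sobolevWeight 2 k * ρ k) ^ 2) :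
    ContinuousOn (nsField ν Uv π P) (box ρ π P) := by
  obtain ⟨L, hL⟩ := norm_nsField_sub_sq_le (ν := ν) hUv hπ hPn hρ0 hρ1 hρ2
  exact continuousOn_of_lipschitz_level hL (box_uniform_tail hρ2)

/-! ## §4 The Galerkin convergence setting of the model from primitive data -/

/-- **THE GALERKIN CONVERGENCE SETTING OF THE TRANSPORT MODEL FROM PRIMITIVE DATA** — the (β2)
item of `HOME/instab/BETA2-SPEC.md` closed: on `E = lp (fun _ : ℤ^d => V) 2` (`V` proper) with the
cube truncations, the field `F = nsField ν Uv π P` and the set of self-consistent bounds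
`W = box ρ π P`, the structure `Literature.Analysis.ODE.GalerkinConvergenceSetting` holds — with the
one-sided constant `l = ω₀ + 10π·card d·R₁` of `TransportGalerkinOneSided.oneSided_nsField` — given
ONLY: the host data (`ν ≥ 0`; `Uv` rapidly decreasing, real `π_j(Uv(−p)) = conj π_j(Uv p)` and
divergence-free `∑_j ∂_j (π_j ∘ Uv) = 0`; `‖π_j‖ ≤ 1`; `P(k)` self-adjoint of norm `≤ 1`), the radii
(`ρ ≥ 0`, `∑⟨l⟩ρ_l < ∞`, `∑⟨k⟩⁴ρ_k² < ∞`), a window `T ≥ 0`, seeds `Z ⊆ W`, and the RESIDENCE data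
(β3): level-`n` Galerkin solutions from `Z` on `[0, T]`, staying in `W` and in the range of `P_n`.
Consumers: `GalerkinEmergenceCertificate.half_prediction_of_head_tail_certificate` /
`decay_two_of_head_tail_certificate` (split `nsField_eq`). -/
theorem galerkinSetting_nsField [ProperSpace V] (hν : 0 ≤ ν) (hUv : RapidDecay Uv)
    (hUreal : ∀ j p, π j (Uv (-p)) = conj (π j (Uv p)))
    (hUdiv : ∑ j, freqDeriv j (fun p => π j (Uv p)) = 0) (hπ : ∀ j, ‖π j‖ ≤ 1)
    (hPsa : ∀ k, IsSelfAdjoint (P k)) (hPn : ∀ k, ‖P k‖ ≤ 1)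
    (hρ0 : ∀ k, 0 ≤ ρ k) (hρ1 : Summable fun k => sobolevWeight 1 k * ρ k)
    (hρ2 : Summable fun k => (sobolevWeight 2 k * ρ k) ^ 2)
    {Z : Set (lp (fun _ : (d → ℤ) => V) 2)} {T : ℝ}
    {u : ℕ → lp (fun _ : (d → ℤ) => V) 2 → ℝ → lp (fun _ : (d → ℤ) => V) 2}
    (hT : 0 ≤ T) (hZ : Z ⊆ box ρ π P)
    (sol_continuousOn : ∀ n, ∀ x ∈ Z, ContinuousOn (u n x) (Icc 0 T))
    (sol_init : ∀ n, ∀ x ∈ Z, u n x 0 = cubeProj n x)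
    (sol_hasDerivAt : ∀ n, ∀ x ∈ Z, ∀ t ∈ Ioo 0 T,
      HasDerivAt (u n x) (cubeProj n (nsField ν Uv π P (u n x t))) t)
    (sol_mem : ∀ n, ∀ x ∈ Z, ∀ t ∈ Icc 0 T, u n x t ∈ box ρ π P)
    (sol_proj : ∀ n, ∀ x ∈ Z, ∀ t ∈ Icc 0 T, cubeProj n (u n x t) = u n x t) :
    GalerkinConvergenceSetting (fun n => (cubeProj n :
        lp (fun _ : (d → ℤ) => V) 2 →L[ℝ] lp (fun _ : (d → ℤ) => V) 2))
      (nsField ν Uv π P) (box ρ π P) Z T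
      ((6 * Real.pi * (∑ j, (symbNorm 2 (scal (fun p => π j (Uv p)) : (d → ℤ) → (V →L[ℂ] V))).toReal)
        + 2 * ((Fintype.card d : ℝ) * (2 * Real.pi)) *
          (∑' l, ENNReal.ofReal (sobolevWeight 3 l) * ‖Uv l‖ₑ).toReal)
        + 10 * Real.pi * (Fintype.card d : ℝ) * (∑' l, sobolevWeight 1 l * ρ l)) u :=
  galerkinSetting_of_residence (summable_sq_of_summable hρ0 hρ1) hT hZ
    (continuousOn_nsField hUv hπ hPn hρ0 hρ1 hρ2)
    (oneSided_nsField hν hUv hUreal hUdiv hπ hPsa hPn hρ0 hρ1)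
    sol_continuousOn sol_init sol_hasDerivAt sol_mem sol_proj

end Summit.NavierStokesRegularity.FluidComputer.TransportGalerkinContinuity

end
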